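import Summits.ValiantsHypothesis.ValiantsHypothesis.Theorems.KPlusLogSqLawTropicalBConcatenation
import Summits.ValiantsHypothesis.ValiantsHypothesis.Theorems.KPlusLogSqLawTropicalBIteratedHalving
import Summits.ValiantsHypothesis.ValiantsHypothesis.Theorems.KPlusLogSqLawTropicalShiftThreeTight
import Summits.ValiantsHypothesis.ValiantsHypothesis.Theorems.KPlusLogSqLawTropicalCensusFiveFourFortyEight
import Summits.ValiantsHypothesis.ValiantsHypothesis.Theorems.KPlusLogSqLawTropicalCensusSixFour
import Summits.ValiantsHypothesis.ValiantsHypothesis.Theorems.KPlusLogSqLawTropicalBStaircaseDesign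
import Summits.ValiantsHypothesis.ValiantsHypothesis.Theorems.KPlusLogSqLawTropicalBPadding

/-!
# Route `KPlusLogSqLaw`, crux `TropicalB` — concatenation ROWS: all-`K` floors from census cells, the `K = 3t` family at
# every size, and the super-fat slope between `C(m+2,2)/3` and `4^(m−1)`

HONEST FRAMING.  Helper file toward the registered stubs `stub_tropThin` / `stub_tropFat` of
`Cruxes/TropicalB/Lines/birth.lean` (crux `Summit.ValiantsHypothesis.ValiantsHypothesis.Theses.KPlusLogSqLaw.TropicalB`,
ledger item `stmt-ValiantsHypothesis-19771`, route `KPlusLogSqLaw`; cell `pub-symmetroid`, seat `val-sym-trop-p4` g6,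
2026-08-27).  Census rows only (LOWER bounds in the super-fat corner `K ≫ m` and at fixed sizes, plus their comparison with
the iterated-halving ceiling); nothing here proves a stub or asserts `TropicalB`, `KPlusLogSqLaw`, `WeakLifting`,
`MatrixDescartes` or anything about `VP ≠ VNP`.

Everything is the θ-concatenation theorem `Concatenation.not_tropRootLawAt_add` (`T(m, K₁+K₂) ≥ T(m,K₁) + T(m,K₂) + 1`,
…TropicalBConcatenation) applied to rows already in the tree:

* `not_tropRootLawAt_mul` — iterate: `¬ TropRootLawAt m K B → ¬ TropRootLawAt m (t·K) (t·(B+2) − 2)` (`t ≥ 1`), i.e.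
  `T(m, t·K) + 1 ≥ t·(T(m,K) + 1)`: every census CELL is an all-`K` floor on its row.
* **`three_classes_family : 1 ≤ m → 1 ≤ t → ¬ TropRootLawAt m (t·3) (t·C(m+2,2) − 2)`** — from the exact `K = 3` row
  `tropRootLawAt_three_iff` (`T(m,3) = C(m+2,2) − 1`, …TropicalShiftThreeTight): `T(m, 3t) + 1 ≥ t·C(m+2,2)` at EVERY
  size — a floor quadratic in `m` and linear in `K`.
* `five_row_floor : ¬ TropRootLawAt 5 (t·4) (t·49 − 2)` and `six_row_floor : ¬ TropRootLawAt 6 (t·4) (t·64 − 2)` (`t ≥ 1`)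
  — from the kernel cells `T(5,4) ≥ 48` (`census_five_four_range_48`) and `T(6,4) ≥ 63` (`census_six_four_range_63`): the
  first all-`K` floors on the rows `m = 5, 6` (`12.25` resp. `16` terms per class; the `K = 3` family gives `7` resp. `28/3`).
* `superFat_sandwich : 1 ≤ m → 1 ≤ t → ¬ TropRootLawAt m (t·3) (t·C(m+2,2) − 2) ∧ TropRootLawAt m (t·3) (4^(m−1)·(t·3) − 1)`
  — the super-fat slope `c_m = lim sup_K T(m,K)/K` lies in `[C(m+2,2)/3, 4^(m−1)]` (upper half: `tropRootLawAt_four_pow`,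
  …TropicalBIteratedHalving).
* `staircase_family : 2 ≤ n → Even n → 1 ≤ L → 1 ≤ t →
  ¬ TropRootLawAt (((2^L−1)(n+1)+1)·(2^L·n·2)) (t·(L+1)) (t·n^L − 2)` — the tree's staircase (`WalkDesign.staircase_lower`:
  `n^L − 1` breakpoints with `L + 1` classes on `≤ 2^(2L+2)·n²` rows) concatenated `t` times: at size `m ≍ 4^L·n²` the slope
  per class is `≥ n^L/(L+1) ≍ (m/4^L)^(L/2)/(L+1)` for every `L`, so `c_m` grows faster than every polynomial in `m`
  (located reading; each fixed `(n, L, t)` instance is the kernel statement).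

READING (located): `c_m` is superpolynomial and at most exponential in `m`; under the small side of Hrubeš–Yehudayoff's Open
Problem 1 it would be `m^{O(log m)}` — the super-fat slope question is that problem up to polynomial factors, not a
separate target. [folklore given the cited tree theorems]
-/

set_option linter.dupNamespace false
set_option autoImplicit false

namespace Summit.ValiantsHypothesis.ValiantsHypothesis.Theorems.KPlusLogSqLaw

open Summit.ValiantsHypothesis.ValiantsHypothesis.Theorems.LacunarySymmetroidMatrixDescartes.TropicalCensus

namespace Concatenation

/-- **Iterated concatenation**: `¬ TropRootLawAt m K B → ¬ TropRootLawAt m (t·K) (t·(B + 2) − 2)` for `t ≥ 1`, i.e.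
`T(m, t·K) + 1 ≥ t·(T(m, K) + 1)`. [folklore] -/
theorem not_tropRootLawAt_mul {m K B : ℕ} (h : ¬ TropRootLawAt m K B) (t : ℕ) (ht : 1 ≤ t) :
    ¬ TropRootLawAt m (t * K) (t * (B + 2) - 2) := by
  induction t with
  | zero => omega
  | succ s ih =>
    rcases Nat.eq_zero_or_pos s with rfl | hs
    · simpa using h
    · have h1 := not_tropRootLawAt_add (ih hs) h
      have e1 : s * K + K = (s + 1) * K := by ring
      have e2 : s * (B + 2) - 2 + B + 2 = (s + 1) * (B + 2) - 2 := by
        have h2 : 2 ≤ s * (B + 2) := by nlinarith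
        have h3 : (s + 1) * (B + 2) = s * (B + 2) + (B + 2) := by ring
        omega
      rw [e1, e2] at h1
      exact h1

/-- **The `K = 3t` family at every size**: `T(m, 3t) + 1 ≥ t·C(m+2,2)` (`m, t ≥ 1`), from the exact three-class row
`T(m,3) = C(m+2,2) − 1` (`tropRootLawAt_three_iff`) by concatenation. [folklore given the tree's theorems] -/
theorem three_classes_family {m : ℕ} (hm : 1 ≤ m) (t : ℕ) (ht : 1 ≤ t) :
    ¬ TropRootLawAt m (t * 3) (t * (m + 2).choose 2 - 2) := by
  have hC : 3 ≤ (m + 2).choose 2 := by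
    calc 3 = (1 + 2).choose 2 := by decide
      _ ≤ (m + 2).choose 2 := Nat.choose_le_choose 2 (by omega)
  have h3 : ¬ TropRootLawAt m 3 ((m + 2).choose 2 - 2) := by
    rw [tropRootLawAt_three_iff]; omega
  have h := not_tropRootLawAt_mul h3 t ht
  rwa [show (m + 2).choose 2 - 2 + 2 = (m + 2).choose 2 by omega] at h

/-- **`m = 5` all-`K` floor**: `T(5, 4t) + 1 ≥ 49t` from the kernel cell `T(5,4) ≥ 48`. [folklore given the tree's cell] -/
theorem five_row_floor (t : ℕ) (ht : 1 ≤ t) : ¬ TropRootLawAt 5 (t * 4) (t * 49 - 2) :=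
  not_tropRootLawAt_mul census_five_four_range_48.2 t ht

/-- **`m = 6` all-`K` floor**: `T(6, 4t) + 1 ≥ 64t` from the kernel cell `T(6,4) ≥ 63`. [folklore given the tree's cell] -/
theorem six_row_floor (t : ℕ) (ht : 1 ≤ t) : ¬ TropRootLawAt 6 (t * 4) (t * 64 - 2) :=
  not_tropRootLawAt_mul census_six_four_range_63.2 t ht

/-- the two cell floors beat the `K = 3` family on their rows (per twelve classes: `147 > 84` at `m = 5`, `192 > 112` at
`m = 6`). [arithmetic] -/
theorem cell_floors_beat_three_family : 3 * 49 > 4 * Nat.choose (5 + 2) 2 ∧ 3 * 64 > 4 * Nat.choose (6 + 2) 2 := by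
  decide

/-- **The super-fat sandwich at every size**: for `m, t ≥ 1`, `t·C(m+2,2) − 1 ≤ T(m, 3t) ≤ 4^(m−1)·3t − 1` — the
slope per class of the tropical census row of size `m` lies between `C(m+2,2)/3` and `4^(m−1)`. [folklore given the tree's
theorems] -/
theorem superFat_sandwich {m : ℕ} (hm : 1 ≤ m) (t : ℕ) (ht : 1 ≤ t) :
    ¬ TropRootLawAt m (t * 3) (t * (m + 2).choose 2 - 2) ∧ TropRootLawAt m (t * 3) (4 ^ (m - 1) * (t * 3) - 1) :=
  ⟨three_classes_family hm t ht, IteratedHalving.tropRootLawAt_four_pow m (t * 3)⟩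

/-- the sandwich is consistent and already wide at `m = 4`: per three classes the floor is `C(6,2) = 15` terms and the
ceiling `3·4^3 = 192`. [arithmetic] -/
theorem sandwich_four : Nat.choose (4 + 2) 2 = 15 ∧ 4 ^ (4 - 1) * 3 = 192 := by decide

/-- **The staircase family, concatenated**: for `n ≥ 2` even, `L ≥ 1`, `t ≥ 1`, at size `m = ((2^L−1)(n+1)+1)·(2^L·n·2)`
(`≤ 2^(2L+2)·n²`, `WalkDesign.staircase_format_le`) and `t·(L+1)` classes there is a sign-alternating dominant chain with
`t·n^L − 1` breakpoints: slope `≥ n^L/(L+1)` per class at size `≍ 4^L n²` — for every `L`, so the super-fat slope is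
superpolynomial in the size. [folklore given the tree's staircase] -/
theorem staircase_family (n L : ℕ) (hn : 2 ≤ n) (he : Even n) (hL : 1 ≤ L) (t : ℕ) (ht : 1 ≤ t) :
    ¬ TropRootLawAt (((2 ^ L - 1) * (n + 1) + 1) * (2 ^ L * n * 2)) (t * (L + 1)) (t * n ^ L - 2) := by
  have hpow : 2 ≤ n ^ L := by
    calc 2 ≤ n := hn
      _ = n ^ 1 := (pow_one n).symm
      _ ≤ n ^ L := Nat.pow_le_pow_right (by omega) hL
  have h1 : ¬ TropRootLawAt (((2 ^ L - 1) * (n + 1) + 1) * (2 ^ L * n * 2)) (L + 1) (n ^ L - 2) := by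
    intro h
    have := WalkDesign.staircase_lower n L hn he hL _ h
    omega
  have h := not_tropRootLawAt_mul h1 t ht
  rwa [show n ^ L - 2 + 2 = n ^ L by omega] at h

/-- a numerical instance of the staircase family: `n = 4`, `L = 2` — size `m = 512`, three classes per copy, `16` breakpoints
per copy: `T(512, 3t) + 1 ≥ 16t`; weaker there than the `K = 3` family (`C(514,2) = 131841` per copy), which is why the
staircase matters only asymptotically in `L`. [arithmetic] -/
theorem staircase_instance_small :
    ((2 ^ 2 - 1) * (4 + 1) + 1) * (2 ^ 2 * 4 * 2) = 512 ∧ Nat.choose (512 + 2) 2 = 131841 := by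
  refine ⟨by decide, ?_⟩
  rw [Nat.choose_two_right]

end Concatenation

end Summit.ValiantsHypothesis.ValiantsHypothesis.Theorems.KPlusLogSqLaw

namespace Summit.ValiantsHypothesis.ValiantsHypothesis.Theorems.KPlusLogSqLaw

open Summit.ValiantsHypothesis.ValiantsHypothesis.Theorems.LacunarySymmetroidMatrixDescartes.TropicalCensus

namespace Concatenation

/-- **Joint superadditivity in (size, classes)**: `¬ TropRootLawAt m₁ K₁ B₁ → ¬ TropRootLawAt m₂ K₂ B₂ →
¬ TropRootLawAt (m₁ + m₂) (K₁ + K₂) (B₁ + B₂ + 2)`, i.e. `T(m₁+m₂, K₁+K₂) ≥ T(m₁,K₁) + T(m₂,K₂) + 1` — θ-concatenation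
(`not_tropRootLawAt_add`) after size padding (`tropRootLawAt_of_le`, …TropicalBPadding).  NOTE (why no pure SIZE superadditivity
`T(m₁+m₂, K) ≥ T(m₁,K) + T(m₂,K)` is recorded): the block-diagonal sum of two witnesses needs ONE exponent vector `d` for both blocks,
and the witnesses of `¬ TropRootLawAt m₁ K B₁`, `¬ TropRootLawAt m₂ K B₂` come with their own; at a fixed `d` the block sum is the
(tight) converse of `designRowD_blockCut` (…TropicalBBlockTriangular), and the chain-surgery tools for it are in
…TropicalBGenericChain (`append_chains`, `exists_scaled_ends`). [folklore given the tree's theorems] -/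
theorem not_tropRootLawAt_add_both {m₁ m₂ K₁ K₂ B₁ B₂ : ℕ} (h₁ : ¬ TropRootLawAt m₁ K₁ B₁) (h₂ : ¬ TropRootLawAt m₂ K₂ B₂) :
    ¬ TropRootLawAt (m₁ + m₂) (K₁ + K₂) (B₁ + B₂ + 2) :=
  not_tropRootLawAt_add (fun h => h₁ (tropRootLawAt_of_le (Nat.le_add_right m₁ m₂) le_rfl h))
    (fun h => h₂ (tropRootLawAt_of_le (Nat.le_add_left m₂ m₁) le_rfl h))

/-- e.g. from the exact three-class rows of two sizes: `T(m₁+m₂, 6) ≥ C(m₁+2,2) + C(m₂+2,2) − 1` (`m₁, m₂ ≥ 1`) — weaker than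
`three_classes_family` at size `m₁ + m₂` (`2·C(m₁+m₂+2,2) − 1`), recorded only to calibrate the joint form. [arithmetic] -/
theorem six_classes_two_sizes {m₁ m₂ : ℕ} (hm₁ : 1 ≤ m₁) (hm₂ : 1 ≤ m₂) :
    ¬ TropRootLawAt (m₁ + m₂) 6 ((m₁ + 2).choose 2 + (m₂ + 2).choose 2 - 2) := by
  have hC₁ : 3 ≤ (m₁ + 2).choose 2 := by
    calc 3 = (1 + 2).choose 2 := by decide
      _ ≤ (m₁ + 2).choose 2 := Nat.choose_le_choose 2 (by omega)
  have hC₂ : 3 ≤ (m₂ + 2).choose 2 := by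
    calc 3 = (1 + 2).choose 2 := by decide
      _ ≤ (m₂ + 2).choose 2 := Nat.choose_le_choose 2 (by omega)
  have h₁ : ¬ TropRootLawAt m₁ 3 ((m₁ + 2).choose 2 - 2) := by rw [tropRootLawAt_three_iff]; omega
  have h₂ : ¬ TropRootLawAt m₂ 3 ((m₂ + 2).choose 2 - 2) := by rw [tropRootLawAt_three_iff]; omega
  have h := not_tropRootLawAt_add_both h₁ h₂
  rwa [show (m₁ + 2).choose 2 - 2 + ((m₂ + 2).choose 2 - 2) + 2 = (m₁ + 2).choose 2 + (m₂ + 2).choose 2 - 2 by omega] at h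

end Concatenation

end Summit.ValiantsHypothesis.ValiantsHypothesis.Theorems.KPlusLogSqLaw
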